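import Summits.ResolutionOfSingularities.ResolutionOfSingularities.Theorems.PurelyInseparableDim4JointForestRoot
import Summits.ResolutionOfSingularities.ResolutionOfSingularities.Theorems.PurelyInseparableDim4JointInstance
import HarnessLib

/-!
# Purely inseparable four-folds: an instance of the monotone joint forest with a POSITIVE-DIMENSIONAL CHILD —
# `z^p + x₁^p (x₁^p x₃ + x₂^p x₄)` is order-reduced by blowing up the 3-fold `V(z, x₁)` and then the SURFACE
# `V(z′, x₁, x₂)` of its `x₁`-chart, for every prime `p` (brick S3 (c) «joint point∘coordinate chains», part 16,
# cell `res-dim4-pi`)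

[OURS · counted 0] (D-0157 DOOR 2; desk WORD #66 (4)(c), #74 (g); frame `PIDim4.TerminationImpliesOrderReduction`,
S3 (c); host item stmt-ResolutionOfSingularities-16155, helper). Nothing here proves resolution of singularities in
dimension ≥ 4 / characteristic `p` — NOT here, not anywhere in this programme.

`F = x₁^p · G`, `G = x₁^p x₃ + x₂^p x₄` (part 5's equation), `K = K̄` of characteristic `p`, any prime `p`. The
non-constant monomials of degree `< p` of `F(x + b)` are `b₁^p` times those of `G(x + b)` (`coeff_translate_inst₃`), so
the closed order-`p` points of `z^p + F` are exactly the 3-fold `{x₁ = 0}` of the hypersurface (`roots_inst₃`, part 5's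
`roots_inst`): ONE initial coordinate member `(0, {x₁})`. In the single chart `x₁` of its blow-up the transform is
`z′^p + G` (`chartTransform_inst₃`, `step_F_inst₃`), whose equimultiple points over the exceptional hyperplane are
exactly those with `x₂ = 0` (`eq_zero_of_isEquimultiplePoint_inst₃`): the PLAN has the one entry `(x₁, 0, {x₁, x₂})` —
a SURFACE CHILD `V(z′, x₁, x₂) ⊋`-planned over `S = {x₁} ⊆ S″ = {x₁, x₂}`, Hironaka-permissible for the child
(part 5's `isPermissibleCentre_inst`) — and no leaf; over the child, part 5's `not_isEquimultiplePoint_inst` says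
no point of either chart is equimultiple, so the plan stops. Hence, by part 15's `exists_isMarkedResolution_joint_forest_root`:

* **`exists_isMarkedResolution_inst₃`** — `(𝔸⁵_K, (z^p + x₁^{2p} x₃ + x₁^p x₂^p x₄)·𝒪, [], p)` admits a marked resolution
  (BGMW Def. 3.1.3): the first kernel instance of the joint forest in which a positive-dimensional centre is followed
  by a positive-dimensional CHILD centre inside its exceptional divisor. UNCONDITIONAL.

§1 computations; §2 the certificate. AI-produced formalisation, weaker than expert review.
bears_on: LADDER-RESOLUTION:D157-DOOR2 (res-dim4-pi · S3 (c) joint v2 · instance).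
-/

set_option linter.dupNamespace false -- D-0017: single-problem summit path `Summit.<S>.<S>.…` by design

noncomputable section

open MvPolynomial Finset CategoryTheory AlgebraicGeometry Opposite TopologicalSpace

namespace Summit.ResolutionOfSingularities.ResolutionOfSingularities.Theorems.PIDim4

open Literature.AlgebraicGeometry.Resolution
open Literature.AlgebraicGeometry.Resolution.Hauser2010
open Literature.AlgebraicGeometry.Resolution.AffinePointBlowup (P A γ coord Wtop ξ)

namespace Equimultiple

section Instance₃

variable {K : Type} [Field K] {p : ℕ} [hp : Fact p.Prime] [CharP K p]

/-! ## §1 Computations for `F = x₁^p (x₁^p x₃ + x₂^p x₄)` and the member `(0, {x₁})` -/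

omit hp [CharP K p] in
/-- `F = x₁^{2p} x₃ + x₁^p x₂^p x₄` as a sum of two monomials. [folklore] -/
theorem inst₃_eq_monomial_add :
    (X 0 ^ p * (X 0 ^ p * X 2 + X 1 ^ p * X 3) : MvPolynomial (Fin 4) K) =
      monomial (Finsupp.single 0 (2 * p) + Finsupp.single 2 1) 1 +
        monomial (Finsupp.single 0 p + Finsupp.single 1 p + Finsupp.single 3 1) 1 := by
  rw [X_pow_mul_X_eq_monomial, X_pow_mul_X_eq_monomial, X_pow_eq_monomial, mul_add, monomial_mul, monomial_mul,
    mul_one, ← add_assoc, ← Finsupp.single_add, ← two_mul, ← add_assoc]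

omit hp [CharP K p] in
/-- The support of `F` lies in its two exponents. [folklore] -/
theorem mem_support_inst₃ {d : Fin 4 →₀ ℕ}
    (hd : d ∈ (X 0 ^ p * (X 0 ^ p * X 2 + X 1 ^ p * X 3) : MvPolynomial (Fin 4) K).support) :
    d = Finsupp.single 0 (2 * p) + Finsupp.single 2 1 ∨
      d = Finsupp.single 0 p + Finsupp.single 1 p + Finsupp.single 3 1 := by
  rw [inst₃_eq_monomial_add] at hd
  rcases Finset.mem_union.mp (Finset.mem_of_subset MvPolynomial.support_add hd) with hd' | hd'
  · exact Or.inl (Finset.mem_singleton.mp (Finset.mem_of_subset support_monomial_subset hd'))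
  · exact Or.inr (Finset.mem_singleton.mp (Finset.mem_of_subset support_monomial_subset hd'))

omit hp [CharP K p] in
/-- `F ≠ 0`. [folklore] -/
theorem inst₃_ne_zero : (X 0 ^ p * (X 0 ^ p * X 2 + X 1 ^ p * X 3) : MvPolynomial (Fin 4) K) ≠ 0 := by
  intro h
  have hc := congrArg (coeff (Finsupp.single (0 : Fin 4) (2 * p) + Finsupp.single 2 1)) h
  rw [inst₃_eq_monomial_add, coeff_add, coeff_monomial, if_pos rfl, coeff_monomial, if_neg, coeff_zero,
    add_zero] at hc
  · exact one_ne_zero hc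
  · intro heq
    have := DFunLike.congr_fun heq 2
    simp at this

omit [CharP K p] in
/-- `F` is clean (each monomial has an exponent `1`). [cite: HauserPerlega2019PRIMS, §2 (cleaning)] -/
theorem isClean_inst₃ :
    Literature.Barriers.ResolutionOfSingularities.HauserPerlega.IsClean p
      (X 0 ^ p * (X 0 ^ p * X 2 + X 1 ^ p * X 3) : MvPolynomial (Fin 4) K) := by
  intro d hd hpth
  rcases mem_support_inst₃ hd with rfl | rfl
  · have h0 : (Finsupp.single 0 (2 * p) + Finsupp.single 2 1 : Fin 4 →₀ ℕ) 2 = 1 := by simp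
    have h := hpth 2 (by rw [Finsupp.mem_support_iff, h0]; exact one_ne_zero)
    rw [h0] at h
    exact hp.out.one_lt.ne' (Nat.dvd_one.mp h)
  · have h0 : (Finsupp.single 0 p + Finsupp.single 1 p + Finsupp.single 3 1 : Fin 4 →₀ ℕ) 3 = 1 := by simp
    have h := hpth 3 (by rw [Finsupp.mem_support_iff, h0]; exact one_ne_zero)
    rw [h0] at h
    exact hp.out.one_lt.ne' (Nat.dvd_one.mp h)

omit hp [CharP K p] in
/-- `Σ_{i ∈ {x₁}} dᵢ = d₁`. [folklore] -/
theorem degIn_singleton_zero (d : Fin 4 →₀ ℕ) : CentreBlowup.degIn ({0} : Finset (Fin 4)) d = d 0 := by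
  rw [CentreBlowup.degIn, Finset.sum_singleton]

omit hp [CharP K p] in
/-- **`V(z, x₁)` is Hironaka-permissible for `z^p + F`**: both monomials have `x₁`-degree `≥ p`.
[cite: HauserPerlega2019PRIMS, §2 (condition (1) f ∈ P^{c!})] -/
theorem isPermissibleCentre_inst₃ :
    IsPermissibleCentre p ({0} : Finset (Fin 4)) (X 0 ^ p * (X 0 ^ p * X 2 + X 1 ^ p * X 3) : MvPolynomial (Fin 4) K) := by
  refine ⟨⟨0, Finset.mem_singleton_self _⟩, Finset.le_inf fun d hd => ?_⟩
  rcases mem_support_inst₃ hd with rfl | rfl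
  · simp [degIn_singleton_zero]
    exact_mod_cast (by omega : p ≤ 2 * p)
  · simp [degIn_singleton_zero]

omit hp [CharP K p] in
/-- **The chart transform of `F` in the (only) chart `x₁` of the blow-up of `V(z, x₁)` is `G = x₁^p x₃ + x₂^p x₄`**
(division by `x₁^p`). [cite: HauserPerlega2019PRIMS, §2 (the blowup in the x₁-chart)] -/
theorem chartTransform_inst₃ :
    CentreBlowup.chartTransform p ({0} : Finset (Fin 4)) 0
        (X 0 ^ p * (X 0 ^ p * X 2 + X 1 ^ p * X 3) : MvPolynomial (Fin 4) K) =
      X 0 ^ p * X 2 + X 1 ^ p * X 3 := by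
  rw [inst₃_eq_monomial_add, CentreBlowup.chartTransform_monomial_add_monomial, CentreBlowup.chartExponent,
    CentreBlowup.chartExponent, degIn_singleton_zero, degIn_singleton_zero]
  have e1 : (Finsupp.single 0 (2 * p) + Finsupp.single 2 1 : Fin 4 →₀ ℕ).update 0
      ((Finsupp.single 0 (2 * p) + Finsupp.single 2 1 : Fin 4 →₀ ℕ) 0 - p) = Finsupp.single 0 p + Finsupp.single 2 1 := by
    ext i; fin_cases i <;> simp [Finsupp.update_apply]
    omega
  have e2 : (Finsupp.single 0 p + Finsupp.single 1 p + Finsupp.single 3 1 : Fin 4 →₀ ℕ).update 0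
      ((Finsupp.single 0 p + Finsupp.single 1 p + Finsupp.single 3 1 : Fin 4 →₀ ℕ) 0 - p) =
        Finsupp.single 1 p + Finsupp.single 3 1 := by
    ext i; fin_cases i <;> simp [Finsupp.update_apply]
  rw [e1, e2, ← X_pow_mul_X_eq_monomial, ← X_pow_mul_X_eq_monomial]

/-- **The low-degree coefficients of `F(x + b)` are `b₁^p` times those of `G(x + b)`**:
`F(x + b) = (x₁^p + b₁^p)·G(x + b)` and `x₁^p·G(x + b)` has no monomial of degree `< p`. [folklore] -/
theorem coeff_translate_inst₃ (b : Fin 4 → K) {d : Fin 4 →₀ ℕ} (hd : d.degree < p) :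
    coeff d (PointBlowup.translate b (X 0 ^ p * (X 0 ^ p * X 2 + X 1 ^ p * X 3) : MvPolynomial (Fin 4) K)) =
      b 0 ^ p * coeff d (PointBlowup.translate b (X 0 ^ p * X 2 + X 1 ^ p * X 3 : MvPolynomial (Fin 4) K)) := by
  have h : PointBlowup.translate b (X 0 ^ p * (X 0 ^ p * X 2 + X 1 ^ p * X 3) : MvPolynomial (Fin 4) K) =
      X 0 ^ p * PointBlowup.translate b (X 0 ^ p * X 2 + X 1 ^ p * X 3) +
        C (b 0 ^ p) * PointBlowup.translate b (X 0 ^ p * X 2 + X 1 ^ p * X 3) := by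
    unfold PointBlowup.translate
    rw [map_mul (aeval _) (X 0 ^ p)]
    simp only [map_pow, aeval_X]
    rw [add_pow_char, ← map_pow, add_mul]
  rw [h, coeff_add, coeff_C_mul, X_pow_eq_monomial, coeff_monomial_mul', if_neg, zero_add]
  intro hle
  have h0 : p ≤ d 0 := by simpa using hle 0
  exact absurd (lt_of_le_of_lt (h0.trans (Finsupp.le_degree 0 d)) hd) (lt_irrefl _)

/-- **The root parameters lie on the member**: if every non-constant monomial of degree `< p` of `F(x + b)` vanishes
then `b₁ = 0` (else those of `G(x + b)` vanish and part 5's `roots_inst` gives `b₁ = 0` anyway).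
[cite: Hauser2010, §F (equiconstant points)] -/
theorem roots_inst₃ (b : Fin 4 → K)
    (H : ∀ d : Fin 4 →₀ ℕ, d ≠ 0 → d.degree < p →
      coeff d (PointBlowup.translate b (X 0 ^ p * (X 0 ^ p * X 2 + X 1 ^ p * X 3) : MvPolynomial (Fin 4) K)) = 0) :
    b 0 = 0 := by
  by_contra h0
  have H' : ∀ d : Fin 4 →₀ ℕ, d ≠ 0 → d.degree < p →
      coeff d (PointBlowup.translate b (X 0 ^ p * X 2 + X 1 ^ p * X 3 : MvPolynomial (Fin 4) K)) = 0 := by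
    intro d hd hdp
    have h := H d hd hdp
    rw [coeff_translate_inst₃ b hdp] at h
    exact (mul_eq_zero.mp h).resolve_left (pow_ne_zero _ h0)
  exact h0 (roots_inst b H' 0 (Finset.mem_insert_self _ _))

omit [CharP K p] in
/-- **The `F`-component of the child state** `step p {x₁} x₁ 0 (F, 0, ∅)` is `G` (chart transform, no translation,
`G` clean). [cite: Hauser2010, §§F–G] [cite: HauserPerlega2019PRIMS, §2] -/
theorem step_F_inst₃ [DecidableEq K] :
    (CentreBlowup.step p ({0} : Finset (Fin 4)) 0 0
        (⟨X 0 ^ p * (X 0 ^ p * X 2 + X 1 ^ p * X 3), 0, ∅⟩ : State K)).F =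
      X 0 ^ p * X 2 + X 1 ^ p * X 3 := by
  show deletePthPowers p (PointBlowup.translate 0 (CentreBlowup.chartTransform p ({0} : Finset (Fin 4)) 0
    (X 0 ^ p * (X 0 ^ p * X 2 + X 1 ^ p * X 3) : MvPolynomial (Fin 4) K))) = _
  rw [chartTransform_inst₃, PointBlowup.translate_zero]
  exact Literature.Barriers.ResolutionOfSingularities.HauserPerlega.deletePthPowers_eq_self isClean_inst

omit hp [CharP K p] in
/-- **The origin of the `x₁`-chart is equimultiple** (`G` has no monomial of degree `< p`): the plan entry
`(x₁, 0, {x₁, x₂})` is an equimultiple pair. [cite: Hauser2010, §F (equiconstant points)] -/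
theorem isEquimultiplePoint_inst₃_zero [DecidableEq K] :
    CentreBlowup.IsEquimultiplePoint p ({0} : Finset (Fin 4)) 0 0
      (⟨X 0 ^ p * (X 0 ^ p * X 2 + X 1 ^ p * X 3), 0, ∅⟩ : State K) := by
  intro d hd hdp
  unfold CentreBlowup.pointTransform
  rw [show (⟨X 0 ^ p * (X 0 ^ p * X 2 + X 1 ^ p * X 3), 0, ∅⟩ : State K).F =
      X 0 ^ p * (X 0 ^ p * X 2 + X 1 ^ p * X 3) from rfl, chartTransform_inst₃, PointBlowup.translate_zero]
  by_contra hne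
  rcases mem_support_inst (MvPolynomial.mem_support_iff.mpr hne) with rfl | rfl
  · rw [map_add, Finsupp.degree_single, Finsupp.degree_single] at hdp
    omega
  · rw [map_add, Finsupp.degree_single, Finsupp.degree_single] at hdp
    omega

/-- **The equimultiple points of the `x₁`-chart have `x₂ = 0`**: they are exactly the points of the surface child
`V(z′, x₁, x₂)`. [cite: Hauser2010, §F (equiconstant points)] -/
theorem eq_zero_of_isEquimultiplePoint_inst₃ [DecidableEq K] {b : Fin 4 → K}
    (h : CentreBlowup.IsEquimultiplePoint p ({0} : Finset (Fin 4)) 0 b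
      (⟨X 0 ^ p * (X 0 ^ p * X 2 + X 1 ^ p * X 3), 0, ∅⟩ : State K)) : b 1 = 0 := by
  unfold CentreBlowup.IsEquimultiplePoint CentreBlowup.pointTransform at h
  rw [show (⟨X 0 ^ p * (X 0 ^ p * X 2 + X 1 ^ p * X 3), 0, ∅⟩ : State K).F =
      X 0 ^ p * (X 0 ^ p * X 2 + X 1 ^ p * X 3) from rfl, chartTransform_inst₃] at h
  exact roots_inst b h 1 (Finset.mem_insert_of_mem (Finset.mem_singleton_self _))

/-! ## §2 The certificate -/

/-- **`z^p + x₁^p (x₁^p x₃ + x₂^p x₄)` ADMITS A MARKED RESOLUTION BY A 3-FOLD BLOW-UP FOLLOWED BY A SURFACE-CHILD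
BLOW-UP** (`K = K̄` of characteristic `p`, every prime `p`): the monotone joint forest at the root with the one initial
member `(0, {x₁})`, the plan `{x₁} ↦ {(x₁, 0, {x₁, x₂})}`, `{x₁, x₂} ↦ ∅`, no leaf and no point member.
[cite: BierstoneGrigorievMilmanWlodarczyk2011, Def. 3.1.3] [cite: HauserPerlega2019PRIMS, §2] [cite: Hauser2010, §F] -/
theorem exists_isMarkedResolution_inst₃ [IsAlgClosed K] [DecidableEq K] :
    ∃ (X' : Scheme.{0}) (ρ : X' ⟶ P 4 K) (M' : MarkedIdeal X'),
      IsMarkedResolution (⟨hypSheaf p (X 0 ^ p * (X 0 ^ p * X 2 + X 1 ^ p * X 3) : MvPolynomial (Fin 4) K), [], p⟩ :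
        MarkedIdeal (P 4 K)) ρ M' := by
  classical
  have h01 : ¬ (({0, 1} : Finset (Fin 4)) = {0}) := by decide
  have hG₀ : deletePthPowers p (PointBlowup.translate (0 : Fin 4 → K)
      (X 0 ^ p * (X 0 ^ p * X 2 + X 1 ^ p * X 3) : MvPolynomial (Fin 4) K)) =
        X 0 ^ p * (X 0 ^ p * X 2 + X 1 ^ p * X 3) := by
    rw [PointBlowup.translate_zero]
    exact Literature.Barriers.ResolutionOfSingularities.HauserPerlega.deletePthPowers_eq_self isClean_inst₃
  set s₀ : State K := ⟨X 0 ^ p * (X 0 ^ p * X 2 + X 1 ^ p * X 3), 0, ∅⟩ with hs₀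
  set s₁ : State K := CentreBlowup.step p ({0} : Finset (Fin 4)) 0 0 s₀ with hs₁
  have hs₁F : s₁.F = X 0 ^ p * X 2 + X 1 ^ p * X 3 := step_F_inst₃
  -- the rules: one planned surface child over the 3-fold, nothing over the child, no leaves
  let plan : State K → Finset (Fin 4) → Finset (Fin 4 × (Fin 4 → K) × Finset (Fin 4)) := fun _ S =>
    if S = ({0} : Finset (Fin 4)) then {((0 : Fin 4), (0 : Fin 4 → K), ({0, 1} : Finset (Fin 4)))} else ∅
  let leaves : State K → Finset (Fin 4) → Finset (Fin 4 × (Fin 4 → K)) := fun _ _ => ∅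
  have hplan₀ : plan s₀ {0} = {((0 : Fin 4), (0 : Fin 4 → K), ({0, 1} : Finset (Fin 4)))} := if_pos rfl
  have hplan₁ : plan s₁ {0, 1} = ∅ := if_neg h01
  have hleaves₀ : leaves s₀ {0} = ∅ := rfl
  have hleaves₁ : leaves s₁ {0, 1} = ∅ := rfl
  -- the states reachable along the plan
  have hreach : ∀ q : State K × Finset (Fin 4),
      Relation.ReflTransGen (fun q q' : State K × Finset (Fin 4) =>
        ∃ e ∈ plan q.1 q.2, q' = (CentreBlowup.step p q.2 e.1 e.2.1 q.1, e.2.2)) (s₀, {0}) q →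
      q = (s₀, {0}) ∨ q = (s₁, {0, 1}) := by
    intro q hq
    induction hq with
    | refl => exact Or.inl rfl
    | tail _ hR ih =>
      obtain ⟨e, he, rfl⟩ := hR
      rcases ih with h | h <;> rw [h] at he ⊢
      · rw [hplan₀, Finset.mem_singleton] at he
        subst he
        exact Or.inr rfl
      · rw [hplan₁] at he
        exact absurd he (Finset.notMem_empty e)
  have hacc₁ : Acc (fun q' q : State K × Finset (Fin 4) =>
      ∃ e ∈ plan q.1 q.2, q' = (CentreBlowup.step p q.2 e.1 e.2.1 q.1, e.2.2)) (s₁, {0, 1}) :=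
    Acc.intro _ fun q' ⟨e, he, _⟩ => by
      rw [hplan₁] at he
      exact absurd he (Finset.notMem_empty e)
  have hacc₀ : Acc (fun q' q : State K × Finset (Fin 4) =>
      ∃ e ∈ plan q.1 q.2, q' = (CentreBlowup.step p q.2 e.1 e.2.1 q.1, e.2.2)) (s₀, {0}) :=
    Acc.intro _ fun q' ⟨e, he, hq'⟩ => by
      rw [hplan₀, Finset.mem_singleton] at he
      subst he
      rw [hq']
      exact hacc₁
  refine exists_isMarkedResolution_joint_forest_root (X 0 ^ p * (X 0 ^ p * X 2 + X 1 ^ p * X 3)) inst₃_ne_zero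
    isClean_inst₃ plan leaves {((0 : Fin 4 → K), ({0} : Finset (Fin 4)))} (fun bS hbS => ?_)
    (fun bS hbS bS' hbS' hne => ?_) (Set.finite_empty.subset ?_) (fun b' H hoff => ?_)
  · -- the member `(0, {x₁})`: permissible, hereditary plan conditions, `Acc`
    rw [Finset.mem_singleton] at hbS
    subst hbS
    dsimp only
    rw [hG₀]
    refine ⟨isPermissibleCentre_inst₃, fun q hq => ?_, hacc₀⟩
    rcases hreach q hq with rfl | rfl <;> dsimp only
    · -- over the 3-fold: the surface child
      rw [hplan₀, hleaves₀]
      refine ⟨fun e he => ?_, fun e he e' he' hne => ?_, fun l hl => absurd hl (Finset.notMem_empty l),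
        fun j' b' hj' hb' heq => ?_⟩
      · rw [Finset.mem_singleton] at he
        subst he
        dsimp only
        refine ⟨Finset.mem_singleton_self _, rfl, Finset.singleton_subset_iff.mpr (Finset.mem_insert_self _ _),
          isEquimultiplePoint_inst₃_zero, ?_⟩
        rw [step_F_inst₃]
        exact isPermissibleCentre_inst
      · rw [Finset.mem_singleton] at he he'
        exact absurd (he.trans he'.symm) hne
      · rw [Finset.mem_singleton] at hj'
        subst hj'
        refine Or.inl ⟨((0 : Fin 4), (0 : Fin 4 → K), ({0, 1} : Finset (Fin 4))), Finset.mem_singleton_self _, rfl,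
          fun i hi => ?_⟩
        dsimp only
        rcases Finset.mem_insert.mp hi with rfl | hi
        · exact hb'
        · rw [Finset.mem_singleton] at hi
          subst hi
          exact eq_zero_of_isEquimultiplePoint_inst₃ heq
    · -- over the surface child: nothing is equimultiple
      rw [hplan₁, hleaves₁]
      refine ⟨fun e he => absurd he (Finset.notMem_empty e), fun e he => absurd he (Finset.notMem_empty e),
        fun l hl => absurd hl (Finset.notMem_empty l), fun j' b' hj' _ heq => ?_⟩
      exfalso
      refine not_isEquimultiplePoint_inst hj' b' ?_
      unfold CentreBlowup.IsEquimultiplePoint CentreBlowup.pointTransform at heq ⊢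
      rw [hs₁F] at heq
      exact heq
  · -- one member only
    rw [Finset.mem_singleton] at hbS hbS'
    exact absurd (hbS.trans hbS'.symm) hne
  · -- no root parameter off the member
    rintro b' ⟨H, hoff⟩
    exact hoff ((0 : Fin 4 → K), {0}) (Finset.mem_singleton_self _) (fun i hi => by
      rw [Finset.mem_singleton] at hi; subst hi; exact roots_inst₃ b' H)
  · exfalso
    exact hoff ((0 : Fin 4 → K), {0}) (Finset.mem_singleton_self _) (fun i hi => by
      rw [Finset.mem_singleton] at hi; subst hi; exact roots_inst₃ b' H)

end Instance₃

end Equimultiple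

end Summit.ResolutionOfSingularities.ResolutionOfSingularities.Theorems.PIDim4

end
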